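import Summits.BirchSwinnertonDyer.BirchSwinnertonDyer.Theorems.EisensteinPrimesMazurMCOnCellBTwistbackDefectSwapUp
import Summits.BirchSwinnertonDyer.BirchSwinnertonDyer.Theorems.EisensteinPrimesMazurMCOnCellBTwistbackTwoStepDefs
import Summits.BirchSwinnertonDyer.Rank1Residual.Partition.GrossZagierTwistValuation
import Summits.BirchSwinnertonDyer.Rank1Residual.X1.RankZeroPartner
import HarnessLib

/-!
# Crux 3 `MazurMCOnCellB` (stmt-BirchSwinnertonDyer-19033), line `twistback` v8/v9 — THE DEFECT SWAP DOWN FROM AN X2c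
# PAIR, and the two-step edge `TwoStepAt p` carries `BSD(p)` FORWARD (from a closed X2b source to its X2b target)

Width seat bsd-line-x2-p1-w3 (gen 14), cell `bsd-eis`, 2026-08-28; lane F2b (sequel of brick F2 = p669353
`…TwistbackDefectSwapUp`); `--supports stmt-BirchSwinnertonDyer-19033 --as helper`. HONEST FRAMING: conditional THEOREMS
ONLY (no `def`, no named fact introduced, no `sorry`); closes no registered stub; no summit statement, no Mazur main
conjecture and no case of BSD is proved for any curve unconditionally; 0 cells / labels / stubs / tiers move.

## What

The two-step edge `TwoStepAt p W W″` (x2-p1-w6 g3, `…TwistbackTwoStepDefs`): `W —K→ Wd —K″→ W″` with `K` admissible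
for the rank-ZERO curve `W` (`r_an(W^{(d_K)}) = 1`) and `K″` admissible for the rank-ONE curve `Wd` (`L(Wd^{(d_K″)},1) ≠ 0`).
So far `BSD(p)` travelled BACKWARDS along it (`W″ ⟹ Wd`: crux 4's twist-partner door p517406; `Wd ⟹ W`: the swapped
display; chains: w6 g3's `…TwistbackTwoStepChain`). F2 (p669353) added `W ⟹ Wd`. This file adds the last arrow
`Wd ⟹ W″` — the display in its ORIGINAL (CGLS (5.6)) orientation, datum on the rank-one curve — and composes:

* §1 `display_of_indexIdentityAt_rankOne` — class-agnostic bookkeeping: for `V/ℚ` globally minimal of conductor `N` with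
  `ord_{s=1} L(V,s) = 1`, `K` admissible for `V` (Heegner for `N`, `p` split, `d_K` odd `< −4`) with `L(V^{(d_K)},1) ≠ 0`, a
  datum `Dt` with `p ∤ c(Dt)` and its Heegner point, `Wd` a minimal model of the twist: the Heegner-index identity
  `X11b.IndexIdentityAt V p K P` ⟹ `defect_p(V) = −defect_p(Wd)` on rational values
  (`TwistIdentity.padicValRat_add_eq_of_grossZagier` + the odd parts of `Ш`, torsion, Tamagawa under `K/ℚ`).
* §2 `bsdp_twist_of_display_of_bsdp_rankOne` — `BSDp V p` (`r_an = 1`) + display + `L(Wd,1)/Ω ∈ ℚ` (modular symbols,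
  `X1.RankZeroPartner.exists_rat_entireLFunction_one_div_realPeriodRat`) ⟹ `BSDp Wd p`.
* §3 `bsdp_twist_of_cellC_of_bsdp_of_kRankOne` — PER PAIR, every Heegner datum DISCHARGED: X2c pair `(V, p)` with
  `BSDp V p` + STEP L = item -27489 `EisensteinPrimes.HeegnerIndexIdentityKRankOne` BY NAME (at `r_an = 1 + 0`) + ONE `K`
  admissible FOR `V` with `L(V^{(d_K)},1) ≠ 0` ⟹ `BSDp Wd p` at EVERY minimal model `Wd` of `V^{(d_K)}` — the per-pair
  converse of crux 4's twist-partner door (rank-zero twist ⟹ `V`).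
* §4 `bsdp_target_of_cellB_of_twoStepAt_of_bsdp` — **the edge is `BSD(p)`-FORWARD**: `X2.CellB W p`, `BSDp W p`,
  `TwoStepAt p W W″` ⟹ `BSDp W″ p` (F2 §2 at `(W, K)`, then §3 at `(Wd, K″)`); with the Ш-unit class datum of v8 at the
  SOURCE (`…_of_classShaUnit`), and along `Relation.ReflTransGen` chains whose nodes are X2b (`…_reflTransGen_…`).
  Together with w6 g3's backward doors every edge carries `BSD(p)` both ways — what a LEAD needs to replace «a Ш-unit
  class REACHABLE from the class of `W`» by «… CONNECTED to it» (said, not filed; W-79).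

HYPOTHESES BY NAME (nothing asserted): `EisensteinPrimes.PublishedInputs` (stmt-…-19037; Cassels, parametrisations,
newforms, Gross–Zagier / Kolyvagin over `K`, GZK, Gross–Zagier I.7.3 are used), Mazur 1978 Cor. 4.1, item -27489; Wuthrich
2014 Prop. 21 in the unit corollary. NOT CLAIMED: no field is produced; nothing class-wide; stub 6‴ untouched.

References: [CastellaEtAl2021] Thm. 5.3.1, (5.5)–(5.7); [GrossZagier1986] I.(6.5), V.§2; [JetchevSkinnerWan2017] §7.4.1;
[KellerYin2024] Thm. D (PRE; what item -27489 would need); [Mazur1978] Cor. 4.1; [Wuthrich2014] Prop. 21;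
[MilneADT2006] Thm. I.7.3; [Miller2011LMS] Def. 1.1; [Darmon2004] Thm. 3.6.
-/

set_option autoImplicit false
-- `Summit.BirchSwinnertonDyer.BirchSwinnertonDyer.…`: the summit and its single sub-problem share a name.
set_option linter.dupNamespace false

noncomputable section

open scoped Classical MatrixGroups ModularForm

open CongruenceSubgroup WeierstrassCurve NumberField
  Literature.NumberTheory.EllipticCurves
  Literature.NumberTheory.EllipticCurves.ModularForms
  Literature.NumberTheory.QuadraticFields
  Literature.NumberTheory.EllipticCurves.KrizLi2019
  Literature.NumberTheory.EllipticCurves.Rank1Residual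
  Literature.NumberTheory.EllipticCurves.Rank1Residual.Typed
  Literature.NumberTheory.EllipticCurves.Wuthrich2014
  Literature.NumberTheory.EllipticCurves.SteinWuthrich2013
  Literature.NumberTheory.EllipticCurves.GreenbergVatsal2000
  Literature.NumberTheory.EllipticCurves.KellerYin2024
  Literature.NumberTheory.GaloisCohomology
  Summit.BirchSwinnertonDyer.Rank1Residual
  Summit.BirchSwinnertonDyer.BirchSwinnertonDyer.Theses
  Summit.BirchSwinnertonDyer.BirchSwinnertonDyer.Theorems
  Summit.BirchSwinnertonDyer.BirchSwinnertonDyer.Theorems.Rank1ResidualX1RankZeroTwist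
  Summit.BirchSwinnertonDyer.BirchSwinnertonDyer.Theorems.EisensteinPrimesMazurMCOnCellBTwistbackTwoStepDefs
  Summit.BirchSwinnertonDyer.BirchSwinnertonDyer.Theorems.EisensteinPrimesMazurMCOnCellBTwistbackDefectSwapUp

namespace Summit.BirchSwinnertonDyer.BirchSwinnertonDyer.Theorems.EisensteinPrimesMazurMCOnCellBTwistbackDefectSwapDown

/-! ## §1. The display in the CGLS orientation: datum on the rank-ONE curve (class-agnostic) -/

/-- **The rank-one display at one Heegner datum from the Heegner-index identity over `K`** (the ORIGINAL orientation of
CGLS (5.5)–(5.7); companion of LEAD g6's `…TwistbackDisplay.displaySwap_of_indexIdentityAt`, which has the datum on the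
rank-zero curve). Data: `W/ℚ` globally minimal of conductor `N`, `ord_{s=1} L(E,s) = 1`, `p ≠ 2`; `K` imaginary quadratic,
`d_K` odd `< −4`, Heegner for `N`, `p` split; `Dt` a parametrisation datum of level `N` with `p ∤ c(Dt)`, `H`, `P ∈ E(K)` its
Heegner point; `L(E^{(d_K)},1) ≠ 0`; `Wd` a globally minimal model of `E^{(d_K)}`; `q = L′(E,1)/(Ω·Reg)`,
`q_d = L(Wd,1)/Ω(Wd)`. Inputs by name: Gross–Zagier (`hGZ`), Kolyvagin (`hKo`), GZK, modularity. If
`X11b.IndexIdentityAt W p K P` holds (granted `Ш(E/K)` finite, which Kolyvagin supplies), then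
`ord_p q − (ord_p #Ш(E) + ord_p ∏c(E) − 2 ord_p #E(ℚ)_tors) = −(ord_p q_d − (ord_p #Ш(Wd) + ord_p ∏c(Wd) − 2 ord_p #Wd(ℚ)_tors))`.
Proof: `TwistIdentity.padicValRat_add_eq_of_grossZagier` (`ord_p q + ord_p q_d = 2 ord_p I − 2 ord_p c − 2 ord_p #E(K)_tors`),
the identity, and the odd parts under `K/ℚ` of `Ш`, torsion and Tamagawa numbers (tree lemmas, as in the swapped display).
[cite: CastellaEtAl2021, proof of Thm. 5.3.1, (5.5)–(5.7)] [cite: GrossZagier1986, I.(6.5) and V.§2 (pp. 310–312)]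
[cite: JetchevSkinnerWan2017, §7.4.1 (eq:gz for K′), p. 30] -/
theorem display_of_indexIdentityAt_rankOne
    (W : WeierstrassCurve ℚ) [W.IsElliptic] [W.IsGloballyMinimal] (p : ℕ) [Fact p.Prime]
    (N : ℕ) [NeZero N] (K : Type) [Field K] [NumberField K]
    (Dt : ModularParametrizationData W N) (H : HeegnerDatum N (NumberField.discr K)) (ι : K →+* ℂ)
    (P : (W.baseChange K).toAffine.Point)
    (hGZ : gross_zagier N W K) (hKo : kolyvagin N W K)
    (hGZK : rank_eq_analyticRank_of_analyticRank_le_one) (hmod : hasEntireLFunction_rat)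
    (hK : IsImaginaryQuadratic K) (hodd : Odd (NumberField.discr K)) (hlt : NumberField.discr K < -4)
    (hN : W.conductorNorm ℤ = N) (hHN : SatisfiesHeegnerHypothesis N K)
    (hHp : SatisfiesHeegnerHypothesis p K)
    (hP : WeierstrassCurve.Affine.Point.map ι.toRatAlgHom P = heegnerPointComplex Dt H)
    (hp2 : p ≠ 2) (hc : ¬ (p : ℤ) ∣ Dt.c) (hr : W.analyticRank = 1)
    (hLt : (W.quadraticTwist (NumberField.discr K : ℚ)).entireLFunction 1 ≠ 0)
    (Wd : WeierstrassCurve ℚ) [Wd.IsElliptic] [Wd.IsGloballyMinimal]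
    (hWd : ∃ C : VariableChange ℚ, C • Wd = W.quadraticTwist (NumberField.discr K : ℚ))
    (hid : Finite (W.baseChange K).sha → X11b.IndexIdentityAt W p K P)
    (q qd : ℚ) (hq : W.leadingLCoeff / ((W.realPeriodRat * W.regulator : ℝ) : ℂ) = (q : ℂ))
    (hqd : Wd.entireLFunction 1 / (Wd.realPeriodRat : ℂ) = (qd : ℂ)) :
    padicValRat p q - ((padicValNat p W.shaOrder : ℤ) + padicValNat p W.tamagawaProduct -
        2 * padicValNat p W.torsionOrder) =
      -(padicValRat p qd - ((padicValNat p Wd.shaOrder : ℤ) + padicValNat p Wd.tamagawaProduct -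
        2 * padicValNat p Wd.torsionOrder)) := by
  have hpp : p.Prime := Fact.out
  haveI hEK : (W.baseChange K).IsElliptic := isElliptic_baseChange' W K
  have h2 : Module.finrank ℚ K = 2 := hK.1
  have hHN' : SatisfiesHeegnerHypothesis (W.conductorNorm ℤ) K := by rw [hN]; exact hHN
  have hD0 : (NumberField.discr K : ℚ) ≠ 0 := by exact_mod_cast NumberField.discr_ne_zero K
  haveI hEt : (W.quadraticTwist (NumberField.discr K : ℚ)).IsElliptic := W.isElliptic_quadraticTwist hD0
  -- the inverse change of variables `Cd • E^{(d_K)} = Wd`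
  obtain ⟨C, hC⟩ := hWd
  set Cd : VariableChange ℚ := C⁻¹ with hCd_def
  have hCd : Cd • W.quadraticTwist (NumberField.discr K : ℚ) = Wd := by rw [← hC, inv_smul_smul]
  -- `p ∤ d_K` (split), `p ∤ w_K = 2`, `ord_p u(Cd) = 0`
  have hpd : ¬ (p : ℤ) ∣ NumberField.discr K := not_dvd_discr_of_split hK hpp hp2 hHp
  have hμ : ¬ p ∣ Units.torsionOrder K := X2.not_dvd_unitsTorsionOrder_of_discr_lt hK hlt hpp hp2
  have hu : padicValRat p (Cd.u : ℚ) = 0 :=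
    AdditivePotMult.padicValRat_u_eq_zero_of_twist_minimal_of_split W p K hK hHp Cd hCd
  -- Kolyvagin: `Ш(E/K)` finite (the Heegner point is non-torsion since `L′(E,1)·L(E^K,1) ≠ 0`)
  have hL0 : W.entireLFunction 1 = 0 := entireLFunction_one_eq_zero_of_analyticRank_eq_one hr
  obtain ⟨-, hderiv⟩ := leadingLCoeff_eq_deriv_of_analyticRank_eq_one hr
  have hprod := lDerivEK_eq_deriv_mul W K hmod hL0
  have hLK : LDerivEK W K ≠ 0 := by
    rw [hprod]; exact mul_ne_zero hderiv hLt
  have hPH : IsHeegnerPoint N W K P := ⟨Dt, H, ι, hP⟩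
  have hPinf : ¬ IsOfFinAddOrder P :=
    (lDerivEK_ne_zero_iff_not_isOfFinAddOrder W N K hGZ hK hHN hPH).mp hLK
  obtain ⟨-, hShaK⟩ := hKo hK hHN hPH hPinf
  haveI hfinK : Finite (W.baseChange K).sha := hShaK
  haveI hfinW : Finite W.sha := Literature.NumberTheory.EllipticCurves.shaFinite_of_baseChange W K hShaK
  have hLt' : (W.quadraticTwist (NumberField.discr K : ℚ)).entireLFunction = Wd.entireLFunction := by
    rw [← hCd, entireLFunction_smul]
  have hrd : Wd.analyticRank = 0 :=
    (Wd.analyticRank_eq_zero_iff_holds (hmod Wd)).2 (by rw [← hLt']; exact hLt)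
  obtain ⟨-, hShad⟩ := hGZK Wd (by omega)
  haveI hfinSd : Finite Wd.sha := hShad
  -- the identity over `K`
  have hKL := hid hfinK
  unfold X11b.IndexIdentityAt at hKL
  -- (5.6) `p`-adically, CGLS orientation
  have h6 := TwistIdentity.padicValRat_add_eq_of_grossZagier W p N K Dt H ι P hGZ hKo hGZK hmod hK hHN hP hp2
    hμ hr hLt Wd Cd hCd hu q qd hq hqd
  -- `Ш`: `v_p(#Ш(E/K)) = v_p(#Ш(E)) + v_p(#Ш(E^K))`
  have hsha : padicValNat p (W.baseChange K).shaOrder =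
      padicValNat p W.shaOrder + padicValNat p Wd.shaOrder := by
    have hcard := card_primaryComponent_sha_baseChange_quadratic_of_odd_of_finite W K h2 Wd
      ⟨Cd, hCd⟩ (W.baseChange K) ⟨1, one_smul _ _⟩ p hp2
    rw [WeierstrassCurve.shaOrder, WeierstrassCurve.shaOrder, WeierstrassCurve.shaOrder,
      ← (Nat.pow_right_injective hpp.two_le).eq_iff, pow_add,
      ← natCard_primaryComponent_eq_pow_padicValNat p, ← natCard_primaryComponent_eq_pow_padicValNat p,
      ← natCard_primaryComponent_eq_pow_padicValNat p]
    exact hcard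
  -- torsion: `v_p(#E(K)_tors) = v_p(#E(ℚ)_tors) + v_p(#E^K(ℚ)_tors)`
  obtain ⟨θ, c, hθ, hcθ⟩ := Quadratic.exists_sq_eq_algebraMap (F := ℚ) (K := K) h2
  obtain ⟨qq, hqq, hdq⟩ := NumberField.exists_discr_eq_mul_sq h2 hθ hcθ
  have htors : padicValNat p (W.baseChange K).torsionOrder =
      padicValNat p W.torsionOrder + padicValNat p Wd.torsionOrder :=
    AdditivePotMult.padicValNat_torsionOrder_baseChange_quadratic_anyRank W K h2 hθ hcθ hqq hdq Wd
      ⟨Cd, hCd⟩ p hp2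
  -- Tamagawa: `v_p(∏c(E^K)) = v_p(∏c(E))`
  have htam : padicValNat p Wd.tamagawaProduct = padicValNat p W.tamagawaProduct :=
    X2.padicValNat_tamagawaProduct_twist_of_heegner_of_odd W p hp2 K hK hodd hpd hHN' Cd hCd
  -- Manin constant prime to `p`
  have hvc : padicValInt p Dt.c = 0 := padicValInt.eq_zero_of_not_dvd hc
  rw [hvc] at h6
  omega

/-! ## §2. `BSDp` at the rank-one curve + display ⟹ `BSDp` at the rank-zero twist (class-agnostic) -/

/-- **`BSD(E,p)` in analytic rank `1` + display ⟹ `BSD(Wd,p)` at the rank-ZERO twist** (bookkeeping). For `W/ℚ` globally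
minimal elliptic with `ord_{s=1} L(E,s) = 1` and `BSDp W p`, ANY globally minimal elliptic `Wd` with `ord_{s=1} L(Wd,s) = 0`,
and the display `hdisp` in the CGLS orientation: Miller's `BSDp Wd p`. Inputs: modularity (`hmod`; and the parametrisation
supply `hpar` for `L(Wd,1)/Ω ∈ ℚ` by modular symbols, `X1.RankZeroPartner.exists_rat_entireLFunction_one_div_realPeriodRat`),
GZK (`hGZK`). Proof: `pPart_of_bsdp` at `W` makes the left side of `hdisp` vanish; `bsdp_of_pPartRankZero` at `Wd`.
[cite: Miller2011LMS, Def. 1.1 (arXiv:1010.2431 p. 3)] [cite: CastellaEtAl2021, proof of Thm. 5.3.1, (5.5)–(5.7)] -/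
theorem bsdp_twist_of_display_of_bsdp_rankOne (hmod : hasEntireLFunction_rat)
    (hGZK : rank_eq_analyticRank_of_analyticRank_le_one) (hpar : nonempty_modularParametrizationData)
    (W : WeierstrassCurve ℚ) [W.IsElliptic] [W.IsGloballyMinimal] (p : ℕ) [Fact p.Prime]
    (hr : W.analyticRank = 1) (hB : BSDp W p)
    (Wd : WeierstrassCurve ℚ) [Wd.IsElliptic] [Wd.IsGloballyMinimal] (hrd : Wd.analyticRank = 0)
    (hdisp : ∀ (q qd : ℚ), W.leadingLCoeff / ((W.realPeriodRat * W.regulator : ℝ) : ℂ) = (q : ℂ) →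
        Wd.entireLFunction 1 / (Wd.realPeriodRat : ℂ) = (qd : ℂ) →
        padicValRat p q - ((padicValNat p W.shaOrder : ℤ) + padicValNat p W.tamagawaProduct -
            2 * padicValNat p W.torsionOrder) =
          -(padicValRat p qd - ((padicValNat p Wd.shaOrder : ℤ) + padicValNat p Wd.tamagawaProduct -
            2 * padicValNat p Wd.torsionOrder))) :
    BSDp Wd p := by
  obtain ⟨q, hq, hv⟩ := pPart_of_bsdp hmod hGZK W p hr.le hB
  obtain ⟨qd, hqd⟩ := X1.RankZeroPartner.exists_rat_entireLFunction_one_div_realPeriodRat hpar Wd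
  have h := hdisp q qd hq hqd
  have hvd : padicValRat p qd = (padicValNat p Wd.shaOrder : ℤ) + padicValNat p Wd.tamagawaProduct -
      2 * padicValNat p Wd.torsionOrder := by
    rw [hv] at h
    linarith
  exact bsdp_of_pPartRankZero Wd p hmod hGZK hrd ⟨qd, hqd, hvd⟩

/-! ## §3. PER PAIR: `BSDp` at an X2c pair + STEP L (item -27489 BY NAME) + `K` admissible for it ⟹ `BSDp` at the twist -/

/-- **DEFECT SWAP DOWN FROM AN X2c PAIR, every Heegner datum DISCHARGED.** Data: `X2.CellC V p` (`ord_{s=1} L(V,s) = 1`,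
`p ≠ 2` multiplicative, `V[p]` reducible; EITHER parity) with `BSDp V p`; `K` imaginary quadratic, Heegner for `N_V` and
for `p`, `d_K` odd `< −4`, `L(V^{(d_K)},1) ≠ 0`; `Wd` ANY globally minimal model of `V^{(d_K)}`. Named facts BY NAME:
`PublishedInputs` (Cassels, parametrisations, newforms, Gross–Zagier / Kolyvagin over `K`, GZK), Mazur 1978 Cor. 4.1, STEP L
= item -27489 `EisensteinPrimes.HeegnerIndexIdentityKRankOne` (at `r_an(V₀) + r_an(V₀^{(d_K)}) = 1 + 0`). Conclusion:
`BSDp Wd p`. Proof: optimal `V₀ ∼ V` with `p ∤ c` (`X2.exists_isIsogenous_hasPrimeToManinDatum`), X2c along the isogeny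
(`X2.cellC_iff_of_isIsogenous`), `N_{V₀} = N_V`, Heegner datum and point (Darmon Thm. 3.6 `_holds`), `BSDp V₀ p` by Cassels,
a minimal model `Wd₀` of `V₀^{(d_K)}`, §1 at `(V₀, Wd₀)`, §2, Cassels to `Wd`. The per-pair CONVERSE of crux 4's
twist-partner door p517406. CONDITIONAL on the named facts. [cite: CastellaEtAl2021, Thm. 5.3.1 and (5.5)–(5.7)]
[cite: KellerYin2024, Thm. D (5.1.3) and §7 (what hSL would need; hypothesis)] [cite: Mazur1978, Cor. 4.1]
[cite: Darmon2004, Thm. 3.6] [cite: MilneADT2006, Thm. I.7.3] [cite: Miller2011LMS, Def. 1.1] -/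
theorem bsdp_twist_of_cellC_of_bsdp_of_kRankOne (hP : EisensteinPrimes.PublishedInputs)
    (hMaz : mazur_not_dvd_maninConstant_of_odd) (hSL : EisensteinPrimes.HeegnerIndexIdentityKRankOne)
    (V : WeierstrassCurve ℚ) [V.IsElliptic] [V.IsGloballyMinimal] (p : ℕ) [Fact p.Prime] (hc : X2.CellC V p)
    (hB : BSDp V p)
    (K : Type) [Field K] [NumberField K] (hK : IsImaginaryQuadratic K)
    (hHN : SatisfiesHeegnerHypothesis (V.conductorNorm ℤ) K) (hHp : SatisfiesHeegnerHypothesis p K)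
    (hoddK : Odd (NumberField.discr K)) (hlt : NumberField.discr K < -4)
    (hL0 : (V.quadraticTwist (NumberField.discr K : ℚ)).entireLFunction 1 ≠ 0)
    (Wd : WeierstrassCurve ℚ) [Wd.IsElliptic] [Wd.IsGloballyMinimal]
    (hWd : ∃ C : VariableChange ℚ, C • Wd = V.quadraticTwist (NumberField.discr K : ℚ)) : BSDp Wd p := by
  have hCassels := hP.2.1
  have hpar := hP.2.2.2.2.1
  have hnf := hP.2.2.2.2.2.1
  have hGZ := hP.2.2.2.2.2.2.2.2.1
  have hKo := hP.2.2.2.2.2.2.2.2.2.1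
  have hGZK := hP.2.2.2.2.2.2.2.2.2.2.1
  have hE : WeierstrassCurve.hasEntireLFunction_rat :=
    WeierstrassCurve.hasEntireLFunction_rat_of_exists_isNewformOf hnf
  have hHP : ∀ (N : ℕ) [NeZero N] (W : WeierstrassCurve ℚ) (K : Type) [Field K] [NumberField K],
      heegnerPointComplex_mem_range_map N W K :=
    fun N _ W K _ _ ↦ heegnerPointComplex_mem_range_map_holds N W K
  have hEd : edixhoven_optimalManinConstant_integral :=
    ModularForms.edixhoven_optimalManinConstant_integral_holds
  have hr : V.analyticRank = 1 := hc.1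
  have hp2 : p ≠ 2 := hc.2.1
  have hmult : V.HasMultiplicativeReductionAtPrime p := hc.2.2.2
  -- the given model of the twist has analytic rank `0`
  obtain ⟨C, hC⟩ := hWd
  have hd0 : (NumberField.discr K : ℚ) ≠ 0 := by exact_mod_cast NumberField.discr_ne_zero K
  haveI := V.isElliptic_quadraticTwist hd0
  have hrt : (V.quadraticTwist (NumberField.discr K : ℚ)).analyticRank = 0 :=
    ((V.quadraticTwist _).analyticRank_eq_zero_iff_holds (hE _)).2 hL0
  have hrd : Wd.analyticRank = 0 := by
    have h := congrArg WeierstrassCurve.analyticRank hC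
    rw [analyticRank_smul] at h
    exact h.trans hrt
  -- the optimal curve `V₀ ∼ V` with `p ∤ c`
  obtain ⟨V₀, hE₀, hM₀, hiso, hMan⟩ :=
    X2.exists_isIsogenous_hasPrimeToManinDatum hEd hMaz hpar hnf V p hp2 hmult
  haveI := hE₀
  haveI := hM₀
  have hc₀ : X2.CellC V₀ p := (X2.cellC_iff_of_isIsogenous (p := p) hiso).mp hc
  have hr₀ : V₀.analyticRank = 1 := hc₀.1
  have hred₀ : ¬ V₀.HasIrreducibleModPGaloisRep p := hc₀.2.2.1
  have hmult₀ : V₀.HasMultiplicativeReductionAtPrime p := hc₀.2.2.2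
  haveI : NeZero (V₀.conductorNorm ℤ) := ⟨(V₀.conductorNorm_pos_holds).ne'⟩
  obtain ⟨Dt, hcM⟩ := hMan
  -- `K` is admissible for `V₀`; the twist keeps analytic rank `0`
  have hN : V.conductorNorm ℤ = V₀.conductorNorm ℤ :=
    conductorNorm_eq_of_isIsogenous_of_modularity_of_isGloballyMinimal hpar hiso
  have hHN₀ : SatisfiesHeegnerHypothesis (V₀.conductorNorm ℤ) K := hN ▸ hHN
  haveI := V₀.isElliptic_quadraticTwist hd0
  have hisoT : IsIsogenous (V.quadraticTwist (NumberField.discr K : ℚ))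
      (V₀.quadraticTwist (NumberField.discr K : ℚ)) := hiso.quadraticTwist hd0
  have hrt₀ : (V₀.quadraticTwist (NumberField.discr K : ℚ)).analyticRank = 0 := by
    rw [← analyticRank_eq_of_isIsogenous' hisoT]; exact hrt
  have hL0₀ : (V₀.quadraticTwist (NumberField.discr K : ℚ)).entireLFunction 1 ≠ 0 :=
    ((V₀.quadraticTwist _).analyticRank_eq_zero_iff_holds (hE _)).1 hrt₀
  -- the Heegner datum and its point
  obtain ⟨β, hβ⟩ := exists_dvd_sq_sub_discr_holds (V₀.conductorNorm ℤ) K hK hHN₀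
  obtain ⟨H, -⟩ := nonempty_heegnerDatum_holds (V₀.conductorNorm ℤ) K hK hβ
  obtain ⟨ι⟩ : Nonempty (K →+* ℂ) := inferInstance
  obtain ⟨P, hPt⟩ := hHP (V₀.conductorNorm ℤ) V₀ K hK hHN₀ Dt H ι
  -- a minimal model of `V₀^{(d_K)}`
  obtain ⟨Wd₀, _, _, C₀, hC₀⟩ := exists_isGloballyMinimal_smul_eq_quadraticTwist V₀ hd0
  have hrd₀ : Wd₀.analyticRank = 0 := by
    have h := congrArg WeierstrassCurve.analyticRank hC₀
    rw [analyticRank_smul] at h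
    exact h.trans hrt₀
  have hisod : IsIsogenous Wd₀ Wd :=
    ((isIsogenous_of_smul_eq hC₀).trans' hisoT.symm_of_charZero).trans' (isIsogenous_of_smul_eq' hC)
  -- `BSDp V₀ p` (Cassels, analytic rank `≤ 1`)
  have hB₀ : BSDp V₀ p :=
    X2.bsdp_of_isIsogenous_of_bsdp hCassels hGZK hE V V₀ hiso p hr.le hB
  -- STEP L at the datum: the `K`-identity, `r_an(V₀/K) = 1 + 0`
  have hid : Finite (V₀.baseChange K).sha → X11b.IndexIdentityAt V₀ p K P := fun hfin ↦
    hSL V₀ p (V₀.conductorNorm ℤ) K Dt H ι P hp2 hmult₀ hred₀ (by rw [hr₀, hrt₀]) rfl hK hoddK hlt hHN₀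
      hPt hcM hfin
  -- the display at `(V₀, Wd₀)`, then down to the twist, then Cassels to the given model
  have hBd₀ : BSDp Wd₀ p :=
    bsdp_twist_of_display_of_bsdp_rankOne hE hGZK hpar V₀ p hr₀ hB₀ Wd₀ hrd₀
      (display_of_indexIdentityAt_rankOne V₀ p (V₀.conductorNorm ℤ) K Dt H ι P (hGZ _ V₀ K) (hKo _ V₀ K)
        hGZK hE hK hoddK hlt rfl hHN₀ hHp hPt hp2 hcM hr₀ hL0₀ Wd₀ ⟨C₀, hC₀⟩ hid)
  exact X2.bsdp_of_isIsogenous_of_bsdp hCassels hGZK hE Wd₀ Wd hisod p (by rw [hrd₀]; omega) hBd₀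

/-! ## §4. The two-step edge carries `BSD(p)` FORWARD -/

/-- **`TwoStepAt p` IS `BSD(p)`-FORWARD**: at an X2b pair `(W, p)` with `BSDp W p`, every two-step edge `TwoStepAt p W W″`
(x2-p1-w6 g3's relation: `K` admissible for `W` with `r_an(W^{(d_K)}) = 1`, a minimal model `Wd`, `K″` admissible for `Wd`
with `L(Wd^{(d_K″)},1) ≠ 0`, `W″` a minimal model of `Wd^{(d_K″)}`) delivers `BSDp W″ p`: F2's
`…DefectSwapUp.bsdp_partner_of_cellB_of_bsdp_of_kRankOne` at `(W, K)` gives `BSDp Wd p`, `(Wd, p)` is X2c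
(`X2.classX2_twist`), and §3 at `(Wd, K″)` gives `BSDp W″ p`. Named facts: `PublishedInputs`, Mazur Cor. 4.1, item -27489
(consumed twice, once in each rank orientation). With w6 g3's `…TwoStepChain.bsdp_of_cellB_of_reflTransGen_twoStepAt_of_bsdp`
(backward) the edge now carries `BSD(p)` in BOTH directions. CONDITIONAL. [cite: CastellaEtAl2021, Thm. 5.3.1 and (5.5)–(5.7)]
[cite: KellerYin2024, Thm. D (5.1.3) and §7 (what hSL would need; hypothesis)] [cite: MilneADT2006, Thm. I.7.3] -/
theorem bsdp_target_of_cellB_of_twoStepAt_of_bsdp (hP : EisensteinPrimes.PublishedInputs)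
    (hMaz : mazur_not_dvd_maninConstant_of_odd) (hSL : EisensteinPrimes.HeegnerIndexIdentityKRankOne)
    {p : ℕ} [Fact p.Prime] {W W'' : WeierstrassCurve ℚ} [W.IsElliptic] [W.IsGloballyMinimal]
    [W''.IsElliptic] [W''.IsGloballyMinimal] (hc : X2.CellB W p) (hB : BSDp W p) (h : TwoStepAt p W W'') :
    BSDp W'' p := by
  obtain ⟨_, _, _, _, K, _, _, hK, hHN, hHp, hoddK, hlt, hr1, Wd, _, _, hWd, K'', _, _, hK'', hodd'', hlt'', hHN'',
    hHp'', hL'', C'', hC''⟩ := h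
  have hd0 : (NumberField.discr K : ℚ) ≠ 0 := by exact_mod_cast NumberField.discr_ne_zero K
  haveI := W.isElliptic_quadraticTwist hd0
  obtain ⟨C, hC⟩ := hWd
  have hrd : Wd.analyticRank = 1 := by
    have h := congrArg WeierstrassCurve.analyticRank hC
    rw [analyticRank_smul] at h
    exact h.trans hr1
  have hBd : BSDp Wd p :=
    bsdp_partner_of_cellB_of_bsdp_of_kRankOne hP hMaz hSL W p hc hB K hK hHN hHp hoddK hlt hr1 Wd ⟨C, hC⟩
  have hcd : X2.CellC Wd p := ⟨hrd, X2.classX2_twist W p hc.2.1 K hK hHp Wd ⟨C, hC⟩⟩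
  exact bsdp_twist_of_cellC_of_bsdp_of_kRankOne hP hMaz hSL Wd p hcd hBd K'' hK'' hHN'' hHp'' hodd'' hlt'' hL'' W''
    ⟨C'', hC''⟩

/-- **Forward along a chain of X2b pairs**: `X2.CellB W p`, `BSDp W p` and `Relation.ReflTransGen (TwoStepAt p) W W″` give
`BSDp W″ p` (induction on the chain; every node is X2b by x2-p1-w6 g3's `cellB_of_cellB_of_reflTransGen_twoStepAt`, the
instances at the nodes are the ones packed in the edges). Named facts: `PublishedInputs`, Mazur Cor. 4.1, item -27489.
CONDITIONAL. [cite: CastellaEtAl2021, Thm. 5.3.1 and (5.5)–(5.7)] [cite: KellerYin2024, Thm. D (5.1.3) and §7 (hypothesis)] -/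
theorem bsdp_target_of_cellB_of_reflTransGen_twoStepAt_of_bsdp (hP : EisensteinPrimes.PublishedInputs)
    (hMaz : mazur_not_dvd_maninConstant_of_odd) (hSL : EisensteinPrimes.HeegnerIndexIdentityKRankOne)
    {p : ℕ} [Fact p.Prime] {W W'' : WeierstrassCurve ℚ} [W.IsElliptic] [W.IsGloballyMinimal]
    [W''.IsElliptic] [W''.IsGloballyMinimal] (hc : X2.CellB W p) (hB : BSDp W p)
    (h : Relation.ReflTransGen (TwoStepAt p) W W'') : BSDp W'' p := by
  have hnf := hP.2.2.2.2.2.1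
  have hE : WeierstrassCurve.hasEntireLFunction_rat :=
    WeierstrassCurve.hasEntireLFunction_rat_of_exists_isNewformOf hnf
  -- strengthen the motive: carry the instances, X2b and `BSDp` along the chain
  suffices H : ∀ V : WeierstrassCurve ℚ, Relation.ReflTransGen (TwoStepAt p) W V →
      ∃ (_ : V.IsElliptic) (_ : V.IsGloballyMinimal), X2.CellB V p ∧ BSDp V p by
    obtain ⟨_, _, -, hBV⟩ := H W'' h
    exact hBV
  intro V hV
  induction hV with
  | refl => exact ⟨inferInstance, inferInstance, hc, hB⟩
  | tail hWU hUV ih =>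
    obtain ⟨hEU, hMU, hcU, hBU⟩ := ih
    obtain ⟨_, _, hEV, hMV, -⟩ := id hUV
    exact ⟨hEV, hMV, cellB_of_cellB_of_twoStepAt hE hcU hUV,
      bsdp_target_of_cellB_of_twoStepAt_of_bsdp hP hMaz hSL hcU hBU hUV⟩

/-- **From a Ш-UNIT CLASS at the SOURCE**: at an X2b pair `(W, p)` carrying v8's class datum (a globally minimal `W' ∼ W`
with `#Ш_an(W')` a rational `p`-unit), every chain `Relation.ReflTransGen (TwoStepAt p) W W″` ends at a pair with
`BSDp W″ p` (Wuthrich Prop. 21 + Cassels at the source via F2's `…DefectSwapUp.bsdp_of_cellB_of_classShaUnit`, then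
`bsdp_target_of_cellB_of_reflTransGen_twoStepAt_of_bsdp`). So a Ш-unit class closes every X2b class DOWNSTREAM of it as
well as (w6 g3) every X2b class UPSTREAM of it. Named facts: `PublishedInputs`, Wuthrich Prop. 21, Mazur Cor. 4.1, item
-27489. CONDITIONAL. [cite: Wuthrich2014, Prop. 21 (p. 400)] [cite: CastellaEtAl2021, Thm. 5.3.1 and (5.5)–(5.7)]
[cite: KellerYin2024, Thm. D (5.1.3) and §7 (hypothesis)] [cite: MilneADT2006, Thm. I.7.3] -/
theorem bsdp_target_of_cellB_of_reflTransGen_twoStepAt_of_classShaUnit (hP : EisensteinPrimes.PublishedInputs)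
    (hW21 : sha_dvd_analyticSha) (hMaz : mazur_not_dvd_maninConstant_of_odd)
    (hSL : EisensteinPrimes.HeegnerIndexIdentityKRankOne)
    {p : ℕ} [Fact p.Prime] {W W'' : WeierstrassCurve ℚ} [W.IsElliptic] [W.IsGloballyMinimal]
    [W''.IsElliptic] [W''.IsGloballyMinimal] (hc : X2.CellB W p)
    (h0 : ∃ (W' : WeierstrassCurve ℚ) (_ : W'.IsElliptic) (_ : W'.IsGloballyMinimal),
      IsIsogenous W W' ∧ ∃ q : ℚ, shaAn W' = (q : ℂ) ∧ padicValRat p q = 0)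
    (h : Relation.ReflTransGen (TwoStepAt p) W W'') : BSDp W'' p :=
  bsdp_target_of_cellB_of_reflTransGen_twoStepAt_of_bsdp hP hMaz hSL hc (bsdp_of_cellB_of_classShaUnit hP hW21 W p hc h0) h

end Summit.BirchSwinnertonDyer.BirchSwinnertonDyer.Theorems.EisensteinPrimesMazurMCOnCellBTwistbackDefectSwapDown

end
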